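import Summits.HodgeConjecture.HodgeConjecture.Cruxes.BlochSeedDiscOne.FinCheck

/-!
# LetterSides — ABOVE tables of the cover-companion letters at h = 6 and the partners (A4) forces (negation g19, pen; `COVER-INTEGRALITY-JOINT.md` v1.5 §C.13, typed reading of the b ∕ a asymmetry of the deep-cover CHAIN)

ABOVE(ℓ) = the alphabet letters amply above `ℓ` (= `FinCheck.upList 6 ℓ` on the alphabet; `FinCheck.upList_six_411 ∕ _033 ∕ _051`
give three REPRESENTATIVES explicitly; here the tables are stated for whole SHAPES, i.e. all sign ∕ swap variants, by kernel `decide`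
over `FinCheck.boxList 6 6`): as shapes,
`ABOVE(a = (4;1,1)) = {H}`, `ABOVE(b = (2;2,2)) = {a, F, H}`, `ABOVE(m = (0;3,3)) = {b, k, a, z, F, H}`
(`H = (6;0,0)`, `F = (5;1,0)`, `z = (4;2,0)`, `k = (3;2,1)`).
DESIGN LEVEL (one line each from `Design.A4`): a present P cell has a present live N partner whose letter in every `a`-slot of the
P cell is the hub `H` (`aSlot_partner_hub`), in every `b`-slot is of shape `a ∕ F ∕ H` (`bSlot_partner`), in every `m`-slot of shape
`b ∕ k ∕ a ∕ z ∕ F ∕ H` (`mSlot_partner`); in particular a P cell with an `a`-letter forces an N cell of the design carrying `H`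
(`hub_of_aLetter`). READING (memo v1.5 §C.13): a deep cover with companion letter `a` (e.g. `m³a`) is covered only through hub letters,
one with companion `b` (e.g. `m³b`) only through `a ∕ F ∕ H` — the stack letter and the hubs.
Route: `boxList 6 6` × `upList 6 ℓ` by `decide`, transported by `mem_boxList ∕ mem_upList` (imports `FinCheck` only; transport helpers
re-proved locally). Sorry-free; no `native_decide`; no instances; no notation.
HONEST FRAMING: finite LETTER-model facts at h = 6 and one-line consequences of `Design.A4`; no LP digit, no region, no floor; nothing here
proves `FloorFree 6 199 8` ∕ `IntegralityGap.Nonex 14 199 8` ∕ 18881 (`BlochSeedDiscOne`) ∕ H2 ∕ HC_AV ∕ HC_CM ∕ HC. Census-neutral.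
-/

set_option linter.dupNamespace false
set_option autoImplicit false

namespace Summit.HodgeConjecture.HodgeConjecture.Cruxes.BlochSeedDiscOne.LetterSides

open Summit.HodgeConjecture.HodgeConjecture.Cruxes.BlochSeedDiscOne.DepthBoundA4
open Summit.HodgeConjecture.HodgeConjecture.Cruxes.BlochSeedDiscOne.FinCheck

/-- an alphabet letter is a box letter (transport helper). -/
theorem alphabet_mem_boxList {ℓ : Letter} (hℓ : ℓ.OnAlphabet 6) : ℓ ∈ boxList 6 6 := by
  refine mem_boxList.mpr ⟨hℓ.1, ?_, ?_⟩
  · have e := hℓ.1; have h0 := hℓ.2; unfold Letter.height at e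
    have := abs_nonneg ℓ.y; push_cast; omega
  · have e := hℓ.1; have h0 := hℓ.2; unfold Letter.height at e
    have := abs_nonneg ℓ.x; push_cast; omega

/-- letters of N support cells are alphabet letters. -/
theorem suppN_onAlphabet {D : Design} (hA : D.OnAlphabet 6) {y : Cell} (hy : y ∈ D.suppN) (f : Fin 4) : (y f).OnAlphabet 6 :=
  hA y (List.mem_append.mpr (Or.inl hy)) f

/-- letters of P support cells are alphabet letters. -/
theorem suppP_onAlphabet {D : Design} (hA : D.OnAlphabet 6) {x : Cell} (hx : x ∈ D.suppP) (f : Fin 4) : (x f).OnAlphabet 6 :=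
  hA x (List.mem_append.mpr (Or.inr hx)) f

/-- sorted absolute coordinates. -/
abbrev absMax (ℓ : Letter) : ℕ := max ℓ.x.natAbs ℓ.y.natAbs
/-- sorted absolute coordinates. -/
abbrev absMin (ℓ : Letter) : ℕ := min ℓ.x.natAbs ℓ.y.natAbs
/-- `ℓ` has shape `(h; u, w)` = height `h` and sorted absolute coordinates `(u, w)`, `u ≥ w`. -/
abbrev HasShape (ℓ : Letter) (h : ℤ) (u w : ℕ) : Prop := ℓ.a = h ∧ absMax ℓ = u ∧ absMin ℓ = w

/-- the hub letter `H = (6;0,0)`, apex of the height-6 alphabet. -/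
def hub : Letter := ⟨6, 0, 0⟩

set_option maxRecDepth 65536 in
/-- ABOVE(a), list form: above a letter of shape `(4;1,1)` lies only the hub (kernel `decide`; cf. `upList_six_411` for the representative). -/
theorem above_a_list : ∀ ℓ ∈ boxList 6 6, 0 ≤ ℓ.a → HasShape ℓ 4 1 1 → ∀ q ∈ upList 6 ℓ, q = hub := by
  decide

set_option maxRecDepth 65536 in
/-- ABOVE(b), list form: above a letter of shape `(2;2,2)` lie only letters of shapes `(4;1,1)`, `(5;1,0)` and the hub. -/
theorem above_b_list : ∀ ℓ ∈ boxList 6 6, 0 ≤ ℓ.a → HasShape ℓ 2 2 2 → ∀ q ∈ upList 6 ℓ,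
    HasShape q 4 1 1 ∨ HasShape q 5 1 0 ∨ q = hub := by
  decide

set_option maxRecDepth 65536 in
/-- ABOVE(m), list form: above a letter of shape `(0;3,3)` lie only letters of shapes `(2;2,2)`, `(3;2,1)`, `(4;1,1)`, `(4;2,0)`, `(5;1,0)`
and the hub (cf. `upList_six_033` for the representative). -/
theorem above_m_list : ∀ ℓ ∈ boxList 6 6, HasShape ℓ 0 3 3 → ∀ q ∈ upList 6 ℓ,
    HasShape q 2 2 2 ∨ HasShape q 3 2 1 ∨ HasShape q 4 1 1 ∨ HasShape q 4 2 0 ∨ HasShape q 5 1 0 ∨ q = hub := by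
  decide

/-- ABOVE(a) on the alphabet. -/
theorem above_a : ∀ ℓ q : Letter, ℓ.OnAlphabet 6 → q.OnAlphabet 6 → HasShape ℓ 4 1 1 → AmpleAbove ℓ q → q = hub := by
  intro ℓ q hℓ hq hs hA
  exact above_a_list ℓ (alphabet_mem_boxList hℓ) hℓ.2 hs q ((mem_upList hℓ).mpr ⟨hq, hA⟩)

/-- ABOVE(b) on the alphabet. -/
theorem above_b : ∀ ℓ q : Letter, ℓ.OnAlphabet 6 → q.OnAlphabet 6 → HasShape ℓ 2 2 2 → AmpleAbove ℓ q →
    HasShape q 4 1 1 ∨ HasShape q 5 1 0 ∨ q = hub := by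
  intro ℓ q hℓ hq hs hA
  exact above_b_list ℓ (alphabet_mem_boxList hℓ) hℓ.2 hs q ((mem_upList hℓ).mpr ⟨hq, hA⟩)

/-- ABOVE(m) on the alphabet. -/
theorem above_m : ∀ ℓ q : Letter, ℓ.OnAlphabet 6 → q.OnAlphabet 6 → HasShape ℓ 0 3 3 → AmpleAbove ℓ q →
    HasShape q 2 2 2 ∨ HasShape q 3 2 1 ∨ HasShape q 4 1 1 ∨ HasShape q 4 2 0 ∨ HasShape q 5 1 0 ∨ q = hub := by
  intro ℓ q hℓ hq hs hA
  exact above_m_list ℓ (alphabet_mem_boxList hℓ) hs q ((mem_upList hℓ).mpr ⟨hq, hA⟩)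

/-! ## Design level: the partners (A4) forces, slot by slot -/

/-- **a-slot partner is the hub.** Every present P cell of an (A4) design on the height-6 alphabet has a present live N partner, and in
every slot where the P cell carries a letter of shape `(4;1,1)` that partner carries `H = (6;0,0)`. -/
theorem aSlot_partner_hub : ∀ D : Design, D.OnAlphabet 6 → D.A4 → ∀ x ∈ D.suppP,
    ∃ y ∈ D.suppN, Live x y ∧ ∀ f : Fin 4, HasShape (x f) 4 1 1 → y f = hub := by
  intro D hA h4 x hx
  obtain ⟨y, hy, hl⟩ := h4.1 x hx
  exact ⟨y, hy, hl, fun f hs => above_a (x f) (y f) (suppP_onAlphabet hA hx f) (suppN_onAlphabet hA hy f) hs (hl f)⟩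

/-- every live N cell above a P cell carries the hub in the P cell's a-slots (all partners, not only one). -/
theorem aSlot_of_live {D : Design} (hA : D.OnAlphabet 6) {x y : Cell} (hx : x ∈ D.suppP) (hy : y ∈ D.suppN) (hl : Live x y)
    (f : Fin 4) (hs : HasShape (x f) 4 1 1) : y f = hub :=
  above_a (x f) (y f) (suppP_onAlphabet hA hx f) (suppN_onAlphabet hA hy f) hs (hl f)

/-- **b-slot partner (P side).** In every slot where a present P cell carries a letter of shape `(2;2,2)`, every live N cell above it
carries a letter of shape `(4;1,1)`, `(5;1,0)` or the hub. -/
theorem bSlot_of_live {D : Design} (hA : D.OnAlphabet 6) {x y : Cell} (hx : x ∈ D.suppP) (hy : y ∈ D.suppN) (hl : Live x y)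
    (f : Fin 4) (hs : HasShape (x f) 2 2 2) : HasShape (y f) 4 1 1 ∨ HasShape (y f) 5 1 0 ∨ y f = hub :=
  above_b (x f) (y f) (suppP_onAlphabet hA hx f) (suppN_onAlphabet hA hy f) hs (hl f)

/-- **m-slot partner.** In every slot where a present P cell carries the deepest floor letter (shape `(0;3,3)`), every live N cell above it
carries a letter of shape `b ∕ k ∕ a ∕ z ∕ F` or the hub. -/
theorem mSlot_of_live {D : Design} (hA : D.OnAlphabet 6) {x y : Cell} (hx : x ∈ D.suppP) (hy : y ∈ D.suppN) (hl : Live x y)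
    (f : Fin 4) (hs : HasShape (x f) 0 3 3) :
    HasShape (y f) 2 2 2 ∨ HasShape (y f) 3 2 1 ∨ HasShape (y f) 4 1 1 ∨ HasShape (y f) 4 2 0 ∨ HasShape (y f) 5 1 0 ∨ y f = hub :=
  above_m (x f) (y f) (suppP_onAlphabet hA hx f) (suppN_onAlphabet hA hy f) hs (hl f)

/-- **hub forced by an a-letter.** If some present P cell carries a letter of shape `(4;1,1)` in slot `f`, then some present N cell carries
the hub `H` in slot `f`. -/
theorem hub_of_aLetter : ∀ D : Design, D.OnAlphabet 6 → D.A4 → ∀ x ∈ D.suppP, ∀ f : Fin 4, HasShape (x f) 4 1 1 →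
    ∃ y ∈ D.suppN, y f = hub := by
  intro D hA h4 x hx f hs
  obtain ⟨y, hy, _, hf⟩ := aSlot_partner_hub D hA h4 x hx
  exact ⟨y, hy, hf f hs⟩

end Summit.HodgeConjecture.HodgeConjecture.Cruxes.BlochSeedDiscOne.LetterSides
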